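import Summits.CriticalPhenomena.PercolationContinuityZ3.Theorems.PercNearOneGluingNoHeavyLowerTailCornerCILFamilies
import Summits.CriticalPhenomena.PercolationContinuityZ3.Theorems.PercNearOneGluingNoHeavyLowerTailCornerEventGluing
import Summits.CriticalPhenomena.PercolationContinuityZ3.Theorems.PercNearOneGluingNoHeavyLowerTailGiantDiamond
import Summits.CriticalPhenomena.PercolationContinuityZ3.Theorems.PercNearOneGluingNoHeavyLowerTailCornerPairCover
import HarnessLib

/-!
# `NoHeavyLowerTail` (stmt-CriticalPhenomena-4575) — corner programme, layer 5b:
# CIL HOLDS TO LEADING ORDER AT THE RELIABLE CORNER, AT EVERY LEVEL `j`, FOR EVERY `|A|`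

CIL_j: `P(1 ≤ |π(o)| ≤ j) ≤ max_{a ∈ A} P(|π(a)| ≤ j)` — the crux's registered engine at the half level
(`stub_cumulativeIsolation`), open in full measure from `(|A|, j) = (5, 2)`; the crux is a LOWER-tail statement
(small `j`).  Here, with NO relation between `j` and `|A|`, along the reliable ray `w = 1 − ε·λ`:
* `Corner.leading_cil_le`: if every `{a light}` has order `≥ m` then `L_m({1 ≤ |π(o)| ≤ j}) ≤ L_m({a light})`
  for some `a ∈ A`;   * `Corner.cil_corner`: `∃ a ∈ A, ∀ γ > 0, ∀ᶠ ε → 0⁺, P_ε(1 ≤ |π(o)| ≤ j) ≤ (1+γ)·P_ε(|π(a)| ≤ j)`.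
Proof. (i) `cil_no_private_triple`: three order-`m` realizer clusters of `o` cannot each own a PRIVATE relay —
`…CutAntichain.cut_inter₃_eq_zero` with the light-set bound `le_card_bdry_of_light` of layer 5a forces the triple
intersection (which contains `o` and from which `o` reaches the first private relay) to have no boundary pair.
(ii) `…CornerPairCover.exists_pair_cover`: hence two relays pierce every realizer cluster, `R_m(cil) = F_{t₁} ∪ F_{t₂}`
(at the half level this was the no-three-antichain of layer 5a; up-families DO have 3-antichains above it).
(iii) Endgame: the GIANT DIAMOND (`…GiantDiamond.giantDiamond`) read at leading order — `P₁Z₁ ≤ Q₁Z₂`,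
`P₂Z₂ ≤ Q₂Z₁` multiply to `P₁P₂ ≤ Q₁Q₂`, where `Pᵢ` dominates the part of `F_{t_{3−i}} ∖ F_{tᵢ}` on which `tᵢ` is
heavy and `Qᵢ` is dominated by the unused part of `L_m({tᵢ light})`.
[folklore] bookkeeping + the landed giant diamond; nothing about the crux is asserted (per-graph asymptotics).
-/

noncomputable section

namespace Summit.CriticalPhenomena.PercolationContinuityZ3.Theorems

open MeasureTheory Filter Topology Finset
open Literature.Probability.LatticeModels Literature.Probability.Percolation

namespace Corner

open scoped Classical

variable {V : Type*} [Fintype V] [DecidableEq V]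

omit [Fintype V] [DecidableEq V] in
/-- `{|π(x)| > j}` as the complement of the light event. [folklore] -/
theorem heavy_eq_compl (A : Finset V) (j : ℕ) (x : V) :
    {ω : BondConfig V | j < (A.filter fun z => ω ∈ openConn x z).card} = (lightEvent A j x)ᶜ := by
  ext ω; simp only [lightEvent, Set.mem_setOf_eq, Set.mem_compl_iff, not_le]

/-- **No private triple.** If every light event `{|π(a)| ≤ j}` (`a ∈ A`) has order `≥ m`, then three order-`m`
realizers of `{1 ≤ |π(o)| ≤ j}` cannot each contain a relay lying in neither of the other two `o`-clusters
(posimodularity: `…CutAntichain.cut_inter₃_eq_zero` with the light-set bound `le_card_bdry_of_light`).  No relation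
between `j` and `|A|` is needed. [folklore] (new here) -/
theorem cil_no_private_triple (E : Finset (Sym2 V)) (m : ℕ) (o : V) (A : Finset V) (j : ℕ)
    (hm : ∀ a ∈ A, ∀ T ∈ E.powerset, (↑T : Set (Sym2 V)) ∈ lightEvent A j a → m ≤ (E \ T).card)
    {S₁ S₂ S₃ : Finset (Sym2 V)} {a₁ a₂ a₃ : V}
    (hS₁ : S₁ ∈ realizers E (cilEvent A j o) m) (hS₂ : S₂ ∈ realizers E (cilEvent A j o) m)
    (hS₃ : S₃ ∈ realizers E (cilEvent A j o) m) (ha₁ : a₁ ∈ A) (ha₂ : a₂ ∈ A) (ha₃ : a₃ ∈ A)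
    (h₁ : a₁ ∈ clus (↑S₁ : Set (Sym2 V)) o) (h₁₂ : a₁ ∉ clus (↑S₂ : Set (Sym2 V)) o) (h₁₃ : a₁ ∉ clus (↑S₃ : Set (Sym2 V)) o)
    (h₂ : a₂ ∈ clus (↑S₂ : Set (Sym2 V)) o) (h₂₁ : a₂ ∉ clus (↑S₁ : Set (Sym2 V)) o) (h₂₃ : a₂ ∉ clus (↑S₃ : Set (Sym2 V)) o)
    (h₃ : a₃ ∈ clus (↑S₃ : Set (Sym2 V)) o) (h₃₁ : a₃ ∉ clus (↑S₁ : Set (Sym2 V)) o) (h₃₂ : a₃ ∉ clus (↑S₂ : Set (Sym2 V)) o) :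
    False := by
  obtain ⟨b₁, hb₁, hF₁⟩ := mem_realizers_cil_iff.1 hS₁
  obtain ⟨b₂, hb₂, hF₂⟩ := mem_realizers_cil_iff.1 hS₂
  obtain ⟨b₃, hb₃, hF₃⟩ := mem_realizers_cil_iff.1 hS₃
  obtain ⟨-, hl₁, hc₁⟩ := clus_facts_of_mem_upFamL hF₁ hb₁ (hm b₁ hb₁)
  obtain ⟨-, hl₂, hc₂⟩ := clus_facts_of_mem_upFamL hF₂ hb₂ (hm b₂ hb₂)
  obtain ⟨-, hl₃, hc₃⟩ := clus_facts_of_mem_upFamL hF₃ hb₃ (hm b₃ hb₃)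
  set U₁ := clus (↑S₁ : Set (Sym2 V)) o
  set U₂ := clus (↑S₂ : Set (Sym2 V)) o
  set U₃ := clus (↑S₃ : Set (Sym2 V)) o
  -- light-set lower bound for subsets of a light cluster through one of its relays
  have low : ∀ {a : V} {U W : Finset V}, a ∈ A → (A ∩ U).card ≤ j → W ⊆ U → a ∈ W →
      (m : ℤ) ≤ ∑ u, ∑ v, if u ∈ W ∧ v ∈ Wᶜ then (↑(mult E u v) : ℤ) else 0 := by
    intro a U W ha hU hWU haW
    rw [← card_bdry_eq_adj]
    have hW : (A ∩ W).card ≤ j := (Finset.card_le_card (Finset.inter_subset_inter le_rfl hWU)).trans hU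
    exact_mod_cast le_card_bdry_of_light (hm a ha) haW hW
  have eqm : ∀ {P : Finset V}, (bdry E P).card = m →
      (∑ u, ∑ v, if u ∈ P ∧ v ∈ Pᶜ then (↑(mult E u v) : ℤ) else 0) = (m : ℤ) := by
    intro P hP; rw [← card_bdry_eq_adj, hP]
  have sd : ∀ {a : V} {P Q : Finset V}, a ∈ P → a ∉ Q → a ∈ P \ Q := fun h h' => Finset.mem_sdiff.2 ⟨h, h'⟩
  have nu : ∀ {a : V} {P Q : Finset V}, a ∉ P → a ∉ Q → a ∉ P ∪ Q := fun h h' => by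
    rw [Finset.mem_union, not_or]; exact ⟨h, h'⟩
  have hz := cut_inter₃_eq_zero (mult E) (mult_comm E) U₁ U₂ U₃ (m : ℤ) (eqm hc₁) (eqm hc₂) (eqm hc₃)
    (low ha₁ hl₁ Finset.sdiff_subset (sd h₁ h₁₂)) (low ha₂ hl₂ Finset.sdiff_subset (sd h₂ h₂₁))
    (low ha₁ hl₁ Finset.sdiff_subset (sd h₁ h₁₃)) (low ha₃ hl₃ Finset.sdiff_subset (sd h₃ h₃₁))
    (low ha₂ hl₂ Finset.sdiff_subset (sd h₂ h₂₃)) (low ha₃ hl₃ Finset.sdiff_subset (sd h₃ h₃₂))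
    (low ha₁ hl₁ Finset.sdiff_subset (sd h₁ (nu h₁₂ h₁₃))) (low ha₂ hl₂ Finset.sdiff_subset (sd h₂ (nu h₂₁ h₂₃)))
    (low ha₃ hl₃ Finset.sdiff_subset (sd h₃ (nu h₃₁ h₃₂)))
  set Z := U₁ ∩ U₂ ∩ U₃ with hZ
  have hZ0 : (bdry E Z).card = 0 := by
    have h := card_bdry_eq_adj E Z
    rw [hz] at h; exact_mod_cast h
  have hoZ : o ∈ Z := by
    simp only [hZ, Finset.mem_inter]
    exact ⟨⟨mem_clus.2 SimpleGraph.Reachable.rfl, mem_clus.2 SimpleGraph.Reachable.rfl⟩,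
      mem_clus.2 SimpleGraph.Reachable.rfl⟩
  have ha₁Z : a₁ ∈ Z := reachable_mem_of_card_bdry_eq_zero (mem_upFamL.1 hF₁).1 hZ0 (mem_clus.1 h₁) hoZ
  exact h₁₂ (Finset.mem_inter.1 (Finset.mem_inter.1 ha₁Z).1).2

/-- **CIL at the corner, coefficient form (every level `j`, all `|A|`).** If every light event `{|π(a)| ≤ j}` has
order `≥ m` on the support, then `L_m({1 ≤ |π(o)| ≤ j}) ≤ L_m({|π(a)| ≤ j})` for some relay `a ∈ A`.
[folklore] (new here) -/
theorem leading_cil_le (E : Finset (Sym2 V)) (lam : Sym2 V → ℝ) (hlam : ∀ e ∈ E, 0 ≤ lam e)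
    (A : Finset V) (j : ℕ) (hAne : A.Nonempty) (o : V) (m : ℕ)
    (hm : ∀ a ∈ A, ∀ T ∈ E.powerset, (↑T : Set (Sym2 V)) ∈ lightEvent A j a → m ≤ (E \ T).card) :
    ∃ a ∈ A, leading E lam (cilEvent A j o) m ≤ leading E lam (lightEvent A j a) m := by
  -- no realizer: the coefficient vanishes
  by_cases h0 : (realizers E (cilEvent A j o) m).Nonempty
  swap
  · obtain ⟨a, ha⟩ := hAne
    refine ⟨a, ha, ?_⟩
    have h00 : famWeight E lam (∅ : Finset (Finset (Sym2 V))) = 0 := by simp [famWeight]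
    rw [leading_eq_famWeight, Finset.not_nonempty_iff_eq_empty.1 h0, h00]
    exact leading_nonneg E lam hlam _ _
  -- two relays pierce every realizer cluster (no private triple ⇒ pair cover)
  set Rl : Finset (Sym2 V) → Finset V := fun S => A ∩ clus (↑S : Set (Sym2 V)) o with hRl
  have hRne : ∀ S ∈ realizers E (cilEvent A j o) m, (Rl S).Nonempty := by
    intro S hS
    obtain ⟨a, ha, hSa⟩ := mem_realizers_cil_iff.1 hS
    exact ⟨a, Finset.mem_inter.2 ⟨ha, (clus_facts_of_mem_upFamL hSa ha (hm a ha)).1⟩⟩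
  obtain ⟨S₁, -, S₂, -, t₁, ht₁R, t₂, ht₂R, hcov⟩ := exists_pair_cover (realizers E (cilEvent A j o) m) Rl h0 hRne
    (fun U₁ hU₁ U₂ hU₂ U₃ hU₃ a₁ ha₁ a₂ ha₂ a₃ ha₃ n₁₂ n₁₃ n₂₁ n₂₃ n₃₁ n₃₂ =>
      cil_no_private_triple E m o A j hm hU₁ hU₂ hU₃ (Finset.mem_inter.1 ha₁).1 (Finset.mem_inter.1 ha₂).1
        (Finset.mem_inter.1 ha₃).1 (Finset.mem_inter.1 ha₁).2
        (fun h => n₁₂ (Finset.mem_inter.2 ⟨(Finset.mem_inter.1 ha₁).1, h⟩))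
        (fun h => n₁₃ (Finset.mem_inter.2 ⟨(Finset.mem_inter.1 ha₁).1, h⟩))
        (Finset.mem_inter.1 ha₂).2
        (fun h => n₂₁ (Finset.mem_inter.2 ⟨(Finset.mem_inter.1 ha₂).1, h⟩))
        (fun h => n₂₃ (Finset.mem_inter.2 ⟨(Finset.mem_inter.1 ha₂).1, h⟩))
        (Finset.mem_inter.1 ha₃).2
        (fun h => n₃₁ (Finset.mem_inter.2 ⟨(Finset.mem_inter.1 ha₃).1, h⟩))
        (fun h => n₃₂ (Finset.mem_inter.2 ⟨(Finset.mem_inter.1 ha₃).1, h⟩)))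
  have ht₁ : t₁ ∈ A := (Finset.mem_inter.1 ht₁R).1
  have ht₂ : t₂ ∈ A := (Finset.mem_inter.1 ht₂R).1
  have hX : realizers E (cilEvent A j o) m = upFamL E m o A j t₁ ∪ upFamL E m o A j t₂ := by
    ext S
    rw [Finset.mem_union]
    constructor
    · intro hS
      obtain ⟨a, ha, hSa⟩ := mem_realizers_cil_iff.1 hS
      rcases hcov S hS with h | h
      · exact Or.inl ((mem_upFamL_iff_mem_clus hSa).2 (Finset.mem_inter.1 h).2)
      · exact Or.inr ((mem_upFamL_iff_mem_clus hSa).2 (Finset.mem_inter.1 h).2)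
    · rintro (h | h)
      · exact mem_realizers_cil_iff.2 ⟨t₁, ht₁, h⟩
      · exact mem_realizers_cil_iff.2 ⟨t₂, ht₂, h⟩
  rw [leading_eq_famWeight, hX]
  by_cases h21 : upFamL E m o A j t₂ ⊆ upFamL E m o A j t₁
  · refine ⟨t₁, ht₁, ?_⟩
    rw [Finset.union_eq_left.2 h21, leading_eq_famWeight]
    exact famWeight_mono hlam (upFamL_subset E m o A j t₁)
  by_cases h12 : upFamL E m o A j t₁ ⊆ upFamL E m o A j t₂
  · refine ⟨t₂, ht₂, ?_⟩
    rw [Finset.union_eq_right.2 h12, leading_eq_famWeight]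
    exact famWeight_mono hlam (upFamL_subset E m o A j t₂)
  have hne : t₁ ≠ t₂ := by rintro rfl; exact h12 le_rfl
  set F₁ := upFamL E m o A j t₁ with hF₁
  set F₂ := upFamL E m o A j t₂ with hF₂
  set R₁ := realizers E (lightEvent A j t₁) m
  set R₂ := realizers E (lightEvent A j t₂) m
  -- split F₂ \ F₁ by the weight of t₁, F₁ \ F₂ by the weight of t₂
  set L₁ := (F₂ \ F₁).filter fun S : Finset (Sym2 V) => (↑S : Set (Sym2 V)) ∈ lightEvent A j t₁
  set H₁ := (F₂ \ F₁).filter fun S : Finset (Sym2 V) => ¬ ((↑S : Set (Sym2 V)) ∈ lightEvent A j t₁)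
  set L₂ := (F₁ \ F₂).filter fun S : Finset (Sym2 V) => (↑S : Set (Sym2 V)) ∈ lightEvent A j t₂
  set H₂ := (F₁ \ F₂).filter fun S : Finset (Sym2 V) => ¬ ((↑S : Set (Sym2 V)) ∈ lightEvent A j t₂)
  have hsplit₁ : famWeight E lam (F₂ \ F₁) = famWeight E lam L₁ + famWeight E lam H₁ := by
    rw [famWeight, famWeight, famWeight, ← Finset.sum_filter_add_sum_filter_not (F₂ \ F₁)
      (fun S : Finset (Sym2 V) => (↑S : Set (Sym2 V)) ∈ lightEvent A j t₁)]
  have hsplit₂ : famWeight E lam (F₁ \ F₂) = famWeight E lam L₂ + famWeight E lam H₂ := by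
    rw [famWeight, famWeight, famWeight, ← Finset.sum_filter_add_sum_filter_not (F₁ \ F₂)
      (fun S : Finset (Sym2 V) => (↑S : Set (Sym2 V)) ∈ lightEvent A j t₂)]
  -- the light parts sit inside R₁ \ F₁ resp. R₂ \ F₂
  have hL₁ : L₁ ⊆ R₁ \ F₁ := by
    intro S hS
    rw [Finset.mem_filter, Finset.mem_sdiff] at hS
    obtain ⟨⟨hS2, hS1⟩, hl⟩ := hS
    obtain ⟨hSE, -, hcard, -⟩ := mem_upFamL.1 hS2
    exact Finset.mem_sdiff.2 ⟨mem_realizers.2 ⟨hSE, hl, hcard⟩, hS1⟩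
  have hL₂ : L₂ ⊆ R₂ \ F₂ := by
    intro S hS
    rw [Finset.mem_filter, Finset.mem_sdiff] at hS
    obtain ⟨⟨hS1, hS2⟩, hl⟩ := hS
    obtain ⟨hSE, -, hcard, -⟩ := mem_upFamL.1 hS1
    exact Finset.mem_sdiff.2 ⟨mem_realizers.2 ⟨hSE, hl, hcard⟩, hS2⟩
  set q₁ := famWeight E lam ((R₁ \ F₁) \ L₁)
  set q₂ := famWeight E lam ((R₂ \ F₂) \ L₂)
  have hW₁ : famWeight E lam (F₁ ∪ F₂) = famWeight E lam F₁ + famWeight E lam L₁ + famWeight E lam H₁ := by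
    rw [famWeight_union_eq, hsplit₁, add_assoc]
  have hW₂ : famWeight E lam (F₁ ∪ F₂) = famWeight E lam F₂ + famWeight E lam L₂ + famWeight E lam H₂ := by
    rw [Finset.union_comm, famWeight_union_eq, hsplit₂, add_assoc]
  have hN₁ : leading E lam (lightEvent A j t₁) m = famWeight E lam F₁ + famWeight E lam L₁ + q₁ := by
    rw [leading_eq_famWeight, famWeight_eq_add_sdiff (upFamL_subset E m o A j t₁), famWeight_eq_add_sdiff hL₁, add_assoc]
  have hN₂ : leading E lam (lightEvent A j t₂) m = famWeight E lam F₂ + famWeight E lam L₂ + q₂ := by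
    rw [leading_eq_famWeight, famWeight_eq_add_sdiff (upFamL_subset E m o A j t₂), famWeight_eq_add_sdiff hL₂, add_assoc]
  by_contra hcon
  simp only [not_exists, not_and, not_le] at hcon
  have hlt₁ := hcon t₁ ht₁; have hlt₂ := hcon t₂ ht₂
  have hpq₁ : q₁ < famWeight E lam H₁ := by linarith
  have hpq₂ : q₂ < famWeight E lam H₂ := by linarith
  have hq₁ : 0 ≤ q₁ := famWeight_nonneg hlam _
  have hq₂ : 0 ≤ q₂ := famWeight_nonneg hlam _
  -- the four giant-diamond events (x = t₂, y = t₁) and the swapped pair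
  set D₁ : Set (Set (Sym2 V)) := (openConn t₂ o : Set (BondConfig V)) ∩ (lightEvent A j t₂ ∩ (lightEvent A j t₁)ᶜ)
  set Z₁ : Set (Set (Sym2 V)) := (lightEvent A j t₂)ᶜ ∩ lightEvent A j t₁
  set D₃ : Set (Set (Sym2 V)) := (openConn t₂ o : Set (BondConfig V)) ∩ ((lightEvent A j t₂)ᶜ ∩ lightEvent A j t₁)
  set Z₂ : Set (Set (Sym2 V)) := lightEvent A j t₂ ∩ (lightEvent A j t₁)ᶜ
  set D₂ : Set (Set (Sym2 V)) := (openConn t₁ o : Set (BondConfig V)) ∩ (lightEvent A j t₁ ∩ (lightEvent A j t₂)ᶜ)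
  set D₄ : Set (Set (Sym2 V)) := (openConn t₁ o : Set (BondConfig V)) ∩ ((lightEvent A j t₁)ᶜ ∩ lightEvent A j t₂)
  -- order hypotheses (each event lies in a light event)
  have ordOf : ∀ {D : Set (Set (Sym2 V))} {t : V}, t ∈ A → D ⊆ lightEvent A j t →
      ∀ S ∈ E.powerset, (↑S : Set (Sym2 V)) ∈ D →
        m ≤ (@SDiff.sdiff (Finset (Sym2 V)) (@Finset.instSDiff (Sym2 V) fun a b => Classical.propDecidable (a = b))
          E S).card := by
    intro D t ht hD S hS hSD
    have h := hm t ht S hS (hD hSD)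
    convert h using 2
    ext e; simp only [Finset.mem_sdiff]
  have o₁ := ordOf (D := D₁) ht₂ (fun S h => h.2.1)
  have oZ₁ := ordOf (D := Z₁) ht₁ (fun S h => h.2)
  have o₃ := ordOf (D := D₃) ht₁ (fun S h => h.2.2)
  have oZ₂ := ordOf (D := Z₂) ht₂ (fun S h => h.1)
  have o₂ := ordOf (D := D₂) ht₁ (fun S h => h.2.1)
  have o₄ := ordOf (D := D₄) ht₂ (fun S h => h.2.2)
  -- giant diamonds at every ε, passed to leading coefficients
  have hGD₁ : leading E lam D₁ m * leading E lam Z₁ m ≤ leading E lam D₃ m * leading E lam Z₂ m := by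
    refine leading_mul_le_of_real_mul_le E lam hlam D₁ Z₁ D₃ Z₂ m o₁ oZ₁ o₃ oZ₂ (Filter.Eventually.of_forall fun ε => ?_)
    have h := giantDiamond (cornerWeight E lam ε) A j hne.symm o
    simp only [heavy_eq_compl] at h
    exact h
  have hGD₂ : leading E lam D₂ m * leading E lam Z₂ m ≤ leading E lam D₄ m * leading E lam Z₁ m := by
    refine leading_mul_le_of_real_mul_le E lam hlam D₂ Z₂ D₄ Z₁ m o₂ oZ₂ o₄ oZ₁ (Filter.Eventually.of_forall fun ε => ?_)
    have h := giantDiamond (cornerWeight E lam ε) A j hne o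
    simp only [heavy_eq_compl] at h
    have e1 : ((lightEvent A j t₁)ᶜ ∩ lightEvent A j t₂ : Set (BondConfig V)) = Z₂ := Set.inter_comm _ _
    have e2 : (lightEvent A j t₁ ∩ (lightEvent A j t₂)ᶜ : Set (BondConfig V)) = Z₁ := Set.inter_comm _ _
    rw [← e1, ← e2]
    exact h
  -- identifications: H₁ ⊆ realizers D₁ ⊆ realizers Z₂; realizers D₃ ⊆ (R₁ \ F₁) \ L₁; and symmetrically
  have hH₁ : H₁ ⊆ realizers E D₁ m := by
    intro S hS
    rw [Finset.mem_filter, Finset.mem_sdiff] at hS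
    obtain ⟨⟨hS2, -⟩, hh⟩ := hS
    obtain ⟨hSE, hj2, hcard, h2o⟩ := mem_upFamL.1 hS2
    refine mem_realizers.2 ⟨hSE, ⟨?_, ?_, hh⟩, hcard⟩
    · exact h2o
    · simp only [lightEvent, Set.mem_setOf_eq, filter_openConn_eq_inter]; exact hj2
  have hH₂ : H₂ ⊆ realizers E D₂ m := by
    intro S hS
    rw [Finset.mem_filter, Finset.mem_sdiff] at hS
    obtain ⟨⟨hS1, -⟩, hh⟩ := hS
    obtain ⟨hSE, hj1, hcard, h1o⟩ := mem_upFamL.1 hS1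
    refine mem_realizers.2 ⟨hSE, ⟨?_, ?_, hh⟩, hcard⟩
    · exact h1o
    · simp only [lightEvent, Set.mem_setOf_eq, filter_openConn_eq_inter]; exact hj1
  have hD₁Z₂ : realizers E D₁ m ⊆ realizers E Z₂ m := fun S hS => by
    obtain ⟨hSE, hD, hcard⟩ := mem_realizers.1 hS
    exact mem_realizers.2 ⟨hSE, hD.2, hcard⟩
  have hD₂Z₁ : realizers E D₂ m ⊆ realizers E Z₁ m := fun S hS => by
    obtain ⟨hSE, hD, hcard⟩ := mem_realizers.1 hS
    exact mem_realizers.2 ⟨hSE, ⟨hD.2.2, hD.2.1⟩, hcard⟩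
  have hD₃ : realizers E D₃ m ⊆ (R₁ \ F₁) \ L₁ := by
    intro S hS
    obtain ⟨hSE, hD, hcard⟩ := mem_realizers.1 hS
    obtain ⟨h2o, hh2, hl1⟩ := hD
    have hR : S ∈ R₁ := mem_realizers.2 ⟨hSE, hl1, hcard⟩
    have hnotF₁ : S ∉ F₁ := fun hF => by
      obtain ⟨-, -, -, h1o⟩ := mem_upFamL.1 hF
      -- o ↔ t₁ and o ↔ t₂ would make t₂ light
      have h21 : (openGraph (↑S : Set (Sym2 V))).Reachable t₂ t₁ := h2o.trans h1o.symm
      apply hh2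
      simp only [lightEvent, Set.mem_setOf_eq, filter_openConn_eq_inter] at hl1 ⊢
      rwa [clus_eq_of_reachable h21]
    have hnotL₁ : S ∉ L₁ := fun hL => by
      rw [Finset.mem_filter, Finset.mem_sdiff] at hL
      obtain ⟨-, hj2, -, -⟩ := mem_upFamL.1 hL.1.1
      apply hh2
      simp only [lightEvent, Set.mem_setOf_eq, filter_openConn_eq_inter]; exact hj2
    exact Finset.mem_sdiff.2 ⟨Finset.mem_sdiff.2 ⟨hR, hnotF₁⟩, hnotL₁⟩
  have hD₄ : realizers E D₄ m ⊆ (R₂ \ F₂) \ L₂ := by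
    intro S hS
    obtain ⟨hSE, hD, hcard⟩ := mem_realizers.1 hS
    obtain ⟨h1o, hh1, hl2⟩ := hD
    have hR : S ∈ R₂ := mem_realizers.2 ⟨hSE, hl2, hcard⟩
    have hnotF₂ : S ∉ F₂ := fun hF => by
      obtain ⟨-, -, -, h2o⟩ := mem_upFamL.1 hF
      have h12 : (openGraph (↑S : Set (Sym2 V))).Reachable t₁ t₂ := h1o.trans h2o.symm
      apply hh1
      simp only [lightEvent, Set.mem_setOf_eq, filter_openConn_eq_inter] at hl2 ⊢
      rwa [clus_eq_of_reachable h12]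
    have hnotL₂ : S ∉ L₂ := fun hL => by
      rw [Finset.mem_filter, Finset.mem_sdiff] at hL
      obtain ⟨-, hj1, -, -⟩ := mem_upFamL.1 hL.1.1
      apply hh1
      simp only [lightEvent, Set.mem_setOf_eq, filter_openConn_eq_inter]; exact hj1
    exact Finset.mem_sdiff.2 ⟨Finset.mem_sdiff.2 ⟨hR, hnotF₂⟩, hnotL₂⟩
  -- numbers
  have mono : ∀ {𝓕 : Finset (Finset (Sym2 V))} {D : Set (Set (Sym2 V))}, 𝓕 ⊆ realizers E D m →
      famWeight E lam 𝓕 ≤ leading E lam D m := fun h => by rw [leading_eq_famWeight]; exact famWeight_mono hlam h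
  have mono' : ∀ {𝓕 : Finset (Finset (Sym2 V))} {D : Set (Set (Sym2 V))}, realizers E D m ⊆ 𝓕 →
      leading E lam D m ≤ famWeight E lam 𝓕 := fun h => by rw [leading_eq_famWeight]; exact famWeight_mono hlam h
  set P₁ := leading E lam D₁ m
  set P₂ := leading E lam D₂ m
  set Q₁ := leading E lam D₃ m
  set Q₂ := leading E lam D₄ m
  set z₁ := leading E lam Z₁ m
  set z₂ := leading E lam Z₂ m
  have hP₁ : famWeight E lam H₁ ≤ P₁ := mono hH₁
  have hP₂ : famWeight E lam H₂ ≤ P₂ := mono hH₂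
  have hQ₁ : Q₁ ≤ q₁ := mono' hD₃
  have hQ₂ : Q₂ ≤ q₂ := mono' hD₄
  have hP₁z₂ : P₁ ≤ z₂ := (mono' hD₁Z₂).trans (mono subset_rfl)
  have hP₂z₁ : P₂ ≤ z₁ := (mono' hD₂Z₁).trans (mono subset_rfl)
  have hQ₁nn : 0 ≤ Q₁ := leading_nonneg E lam hlam D₃ m
  have hQ₂nn : 0 ≤ Q₂ := leading_nonneg E lam hlam D₄ m
  have hgt₁ : Q₁ < P₁ := by linarith
  have hgt₂ : Q₂ < P₂ := by linarith
  -- from the two diamonds: (P₁ P₂ - Q₁ Q₂) z₁ z₂ ≤ 0, while P₂ ≤ z₁ and P₁ ≤ z₂ force z₁, z₂ > 0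
  have hz₁pos : 0 < z₁ := lt_of_lt_of_le (lt_of_le_of_lt hQ₂nn hgt₂) hP₂z₁
  have hz₂pos : 0 < z₂ := lt_of_lt_of_le (lt_of_le_of_lt hQ₁nn hgt₁) hP₁z₂
  have hz₂ : 0 ≤ z₂ := hz₂pos.le
  have hP₂nn : 0 ≤ P₂ := leading_nonneg E lam hlam D₂ m
  have h4 : (P₁ * z₁) * (P₂ * z₂) ≤ (Q₁ * z₂) * (Q₂ * z₁) :=
    mul_le_mul hGD₁ hGD₂ (mul_nonneg hP₂nn hz₂) (mul_nonneg hQ₁nn hz₂)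
  have hprod : P₁ * P₂ * (z₁ * z₂) ≤ Q₁ * Q₂ * (z₁ * z₂) := by
    calc P₁ * P₂ * (z₁ * z₂) = (P₁ * z₁) * (P₂ * z₂) := by ring
      _ ≤ (Q₁ * z₂) * (Q₂ * z₁) := h4
      _ = Q₁ * Q₂ * (z₁ * z₂) := by ring
  have hPQ : P₁ * P₂ ≤ Q₁ * Q₂ := le_of_mul_le_mul_right hprod (mul_pos hz₁pos hz₂pos)
  have hlt : Q₁ * Q₂ < P₁ * P₂ := mul_lt_mul'' hgt₁ hgt₂ hQ₁nn hQ₂nn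
  linarith

/-- **CIL at the reliable corner (every level `j`, every `|A|`).** For every finite vertex type, support `E`,
rates `λ > 0`, nonempty relay set `A`, level `j` and observer `o`: there is ONE relay `a ∈ A` such that for every
`γ > 0`, eventually as `ε → 0⁺` along `w = 1 − ε·λ`,  `P_ε(1 ≤ |π(o)| ≤ j) ≤ (1 + γ)·P_ε(|π(a)| ≤ j)`.
[folklore] (new here) -/
theorem cil_corner (E : Finset (Sym2 V)) (lam : Sym2 V → ℝ) (hlam : ∀ e ∈ E, 0 < lam e)
    (A : Finset V) (j : ℕ) (hAne : A.Nonempty) (o : V) :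
    ∃ a ∈ A, ∀ γ : ℝ, 0 < γ → ∀ᶠ ε in 𝓝[>] (0 : ℝ),
      (prodBernoulli (cornerWeight E lam ε)).real (cilEvent A j o) ≤
        (1 + γ) * (prodBernoulli (cornerWeight E lam ε)).real (lightEvent A j a) := by
  have hlam' : ∀ e ∈ E, 0 ≤ lam e := fun e he => (hlam e he).le
  have bridge : ∀ {D : Set (Set (Sym2 V))} {m : ℕ},
      (∀ S ∈ E.powerset, (↑S : Set (Sym2 V)) ∈ D → m ≤ (E \ S).card) →
      ∀ S ∈ E.powerset, (↑S : Set (Sym2 V)) ∈ D →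
        m ≤ (@SDiff.sdiff (Finset (Sym2 V)) (@Finset.instSDiff (Sym2 V) fun a b => Classical.propDecidable (a = b))
          E S).card := by
    intro D m h S hS hD
    have h' := h S hS hD
    convert h' using 2
    ext e; simp only [Finset.mem_sdiff]
  by_cases hX : (E.powerset.filter fun S : Finset (Sym2 V) => (↑S : Set (Sym2 V)) ∈ cilEvent A j o).Nonempty
  · obtain ⟨S₀, hS₀, hmin⟩ := Finset.exists_min_image _ (fun S => (E \ S).card) hX
    rw [Finset.mem_filter] at hS₀
    set m := (E \ S₀).card with hm
    have hXord : ∀ S ∈ E.powerset, (↑S : Set (Sym2 V)) ∈ cilEvent A j o → m ≤ (E \ S).card :=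
      fun S hS hD => hmin S (Finset.mem_filter.2 ⟨hS, hD⟩)
    have hXpos : 0 < leading E lam (cilEvent A j o) m :=
      leading_pos_of_mem_realizers hlam (mem_realizers.2 ⟨Finset.mem_powerset.1 hS₀.1, hS₀.2, rfl⟩)
    by_cases hlow : ∃ a ∈ A, ∃ S ∈ E.powerset, (↑S : Set (Sym2 V)) ∈ lightEvent A j a ∧ (E \ S).card < m
    · obtain ⟨a, ha, S₁, hS₁, hS₁D, hlt⟩ := hlow
      have hne : (E.powerset.filter fun S : Finset (Sym2 V) => (↑S : Set (Sym2 V)) ∈ lightEvent A j a).Nonempty :=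
        ⟨S₁, Finset.mem_filter.2 ⟨hS₁, hS₁D⟩⟩
      obtain ⟨S₂, hS₂, hmin₂⟩ := Finset.exists_min_image _ (fun S => (E \ S).card) hne
      rw [Finset.mem_filter] at hS₂
      set m' := (E \ S₂).card with hm'
      have hm'lt : m' < m := lt_of_le_of_lt (hmin₂ S₁ (Finset.mem_filter.2 ⟨hS₁, hS₁D⟩)) hlt
      have h₂ : ∀ S ∈ E.powerset, (↑S : Set (Sym2 V)) ∈ lightEvent A j a → m' ≤ (E \ S).card :=
        fun S hS hD => hmin₂ S (Finset.mem_filter.2 ⟨hS, hD⟩)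
      have h₁ : ∀ S ∈ E.powerset, (↑S : Set (Sym2 V)) ∈ cilEvent A j o → m' ≤ (E \ S).card :=
        fun S hS hD => hm'lt.le.trans (hXord S hS hD)
      have hpos : 0 < leading E lam (lightEvent A j a) m' :=
        leading_pos_of_mem_realizers hlam (mem_realizers.2 ⟨Finset.mem_powerset.1 hS₂.1, hS₂.2, rfl⟩)
      have hzero : leading E lam (cilEvent A j o) m' = 0 :=
        leading_eq_zero_of_forall fun S hS hD => ne_of_gt (hm'lt.trans_le (hXord S hS hD))
      refine ⟨a, ha, fun γ hγ => ?_⟩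
      exact eventually_real_le_mul_of_leading_le E lam hlam' _ _ m' (bridge h₁) (bridge h₂) hpos
        (by rw [hzero]; exact hpos.le) hγ
    · have hm_all : ∀ a ∈ A, ∀ T ∈ E.powerset, (↑T : Set (Sym2 V)) ∈ lightEvent A j a → m ≤ (E \ T).card := by
        intro a ha T hT hD
        by_contra hlt
        exact hlow ⟨a, ha, T, hT, hD, not_le.mp hlt⟩
      obtain ⟨a, ha, hle⟩ := leading_cil_le E lam hlam' A j hAne o m hm_all
      refine ⟨a, ha, fun γ hγ => ?_⟩
      exact eventually_real_le_mul_of_leading_le E lam hlam' _ _ m (bridge hXord) (bridge (hm_all a ha))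
        (hXpos.trans_le hle) hle hγ
  · obtain ⟨a, ha⟩ := hAne
    refine ⟨a, ha, fun γ hγ => ?_⟩
    filter_upwards [eventually_small E lam hlam'] with ε hε
    have h0 : (prodBernoulli (cornerWeight E lam ε)).real (cilEvent A j o) = 0 := by
      rw [real_eq_sum_powerset E lam ε hε.2]
      refine Finset.sum_eq_zero fun S hS => ?_
      rw [if_neg]
      exact fun hD => hX ⟨S, Finset.mem_filter.2 ⟨hS, hD⟩⟩
    rw [h0]
    exact mul_nonneg (by linarith) measureReal_nonneg

end Corner

end Summit.CriticalPhenomena.PercolationContinuityZ3.Theorems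
end
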